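import Summits.QuantumFields.YangMills.Theorems.AlphaInputsT3ACv3LaneChi
import Summits.QuantumFields.YangMills.Theorems.AlphaInputsT3ACv3Core
import HarnessLib

/-!
# `AlphaInputsT3ACv3Chi` — THE (α) SOCKET AT THE T³ OBJECTS WITH PRINT'S LOWER ROW («R-57χ» ADDITIVE form, owner RULING g23-№2 ADDENDA 2/5/6, cell ym3-torus, 2026-08-27):
# `AlphaInputsT3AC.OfV3ChiAt F 𝔠 a₀ a₁` and the record-parametric closed proposition `AlphaInputsT3ACv3RecChi L` (= the successor stub 2′χ's record), the package
# `PkgAtV3Chi` (projects to the data core `PkgCoreV3`), and print's (47) for it: `dV`-a.e. on print's validity family and on the INTERIOR field window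
# `θBal/max(B₃,1)` ([Balaban1985Variational] Thm 1 (8) = the record's minimiser row r1), the form the 19936 denominator and E-INT read — lane `pub-balaban3d`, seat alpha-1 (g9)

WHAT CHANGES vs `AlphaInputsT3ACv3` (NAME MAP, owner ADDENDUM 6 §2; every field name unchanged): `OfV3At ↦ OfV3ChiAt`, `AlphaInputsT3ACv3Rec ↦ AlphaInputsT3ACv3RecChi`,
`PkgAtV3 ↦ PkgAtV3Chi` (field `run : RunAlphaV3ChiAC …` in place of `RunAlphaV3AC …`), the (41)-side API is the CORE's (`PkgAtV3Chi.toCore : PkgCoreV3`, file `AlphaInputsT3ACv3Core`),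
and the (47)-side API is NEW: `PkgAtV3Chi.ineq47Print_ae` (a.e. on `PinnedStep.loPrintAC`), `intWindowT3`/`intWindowT3_subset_loPrintAC` (the interior window lies in print's family by
row r1), `PkgAtV3Chi.ineq47Int_ae`, `PkgAtV3Chi.le_resDensity_int_ae` ((47)′ for the route's density with the INTERIOR indicator, constants pulled out — the statement 19936's
denominator consumes with `χ := 𝟙[interior]`).  The old `PkgAtV3.ineq47` (pointwise, tower's (4)-window) has no counterpart: it ran through the retired R3D-02.
`OfV3ChiAt`/`AlphaInputsT3ACv3RecChi` are OPEN hypothesis schemas, never asserted; everything else here is proved.  L-floor: `Odd L ∧ 1 < L`.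

References: T. Bałaban, Commun. Math. Phys. 102 (1985) 255–275 [Balaban1985UV3]; Commun. Math. Phys. 102 (1985) 277–309 [Balaban1985Variational].
-/

set_option autoImplicit false

noncomputable section

namespace Summit.QuantumFields.YangMills.Theorems

open MeasureTheory
open scoped BigOperators
open Literature.MathematicalPhysics.QuantumFieldTheory.Balaban1983to89
open Literature.MathematicalPhysics.QuantumFieldTheory.Balaban1983to89.B10 (Ineq47)
open Literature.MathematicalPhysics.QuantumFieldTheory.Balaban1983to89.T3ContinuumYM3Torus
open Literature.MathematicalPhysics.QuantumFieldTheory.Balaban1983to89.T3UnitLawDensityEML (ℰp)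
open Literature.MathematicalPhysics.QuantumFieldTheory.Balaban1983to89.T3UnitScaleTilt (θBal)
open Literature.MathematicalPhysics.QuantumFieldTheory.Balaban1983to89.T3LevelShift (fieldShift)
open Literature.MathematicalPhysics.QuantumFieldTheory.Balaban1983to89.T3PrintedRegularMinimiser (regFibrePr minActionRegPr)
open Literature.MathematicalPhysics.QuantumFieldTheory.Balaban1983to89.T3PrintedMinimiserExistence (regFibrePr_mono minActionRegPr_eq_of_isMinOn)
open Literature.MathematicalPhysics.QuantumFieldTheory.Balaban1983to89.T3RestrictedUnitDensity (towerDensity resDensity)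
open Literature.MathematicalPhysics.QuantumFieldTheory.Balaban1983to89.Missing (boltzmann)
open Literature.MathematicalPhysics.QuantumFieldTheory.Balaban1983to89.B10Eq38TorusDomains (plaqsIn)
open Literature.MathematicalPhysics.QuantumFieldTheory.Balaban1983to89.B10Eq42TorusConstraint (bondsIn lam42)
open Literature.MathematicalPhysics.QuantumFieldTheory.Balaban1985CMP102
open Literature.MathematicalPhysics.QuantumFieldTheory.Balaban1985CMP102.Setting
open Summit.QuantumFields.Balaban3D.Carriers
open Summit.QuantumFields.Balaban3D.Proofs.Primitives
open Summit.QuantumFields.Balaban3D.Proofs.Inputs (rcoefOf_carrier)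
open Summit.QuantumFields.Balaban3D.Proofs.GroupModelLieC (lieC)
open Summit.QuantumFields.Balaban3D.Proofs.TowerAC
open Summit.QuantumFields.Balaban3D.Proofs.StandardAC
open Summit.QuantumFields.Balaban3D.Proofs.InputsAC
open Summit.QuantumFields.Balaban3D.Proofs.AlphaAC (AlphaDataAC)
open Summit.QuantumFields.YangMills.Theorems.AlphaV3AC
open Literature.MathematicalPhysics.QuantumFieldTheory.Balaban1983to89.T3RegularMinimiser (regThreshold)

/-! ## §1 The χ-package at given constants and the record-parametric closed proposition -/

/-- **(α) AT THE T³ OBJECTS WITH PRINT'S LOWER ROW, AT GIVEN [7] CONSTANTS `a₀, a₁`** (hypothesis schema, OPEN, never asserted): `AlphaInputsT3AC.OfV3At`'s text with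
`RunAlphaV3AC ↦ RunAlphaV3ChiAC` — for every coupling `γ ∈ (0, (min γ₀ 1)²]` and every `K`, minimizer data, expansion data and auxiliary data with (i) the χ-record's (α) rows
`AlphaV3AC.RunAlphaV3ChiAC` for the pinned inputs `XT3` and the (40) windows `admWindowT3` (the core rows + print's lower row on `PinnedStep.loPrintAC`), (ii) the minimiser rows
`MinimiserRowsT3 … a₀ a₁ K UkH`, (iii) the terminal rows. [cite: Balaban1985UV3, Thm 2 p.272 + (40)–(41) p.266 + (47) p.267 + (55) p.269; Balaban1985Variational, Thm 1 (8) p.279] -/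
def AlphaInputsT3AC.OfV3ChiAt (F : T3Family) (𝔠 : AlphaConsts F.L (suGroupModel 2).N) (a₀ a₁ : ℝ) : Prop :=
  ∀ (γ : ℝ) (hγ : 0 < γ) (hγ1 : γ ≤ (min 𝔠.gamma0 1) ^ 2) (K : ℕ),
    ∃ (reg : ℕ → Set (GaugeField (F.P K) 0 (Matrix.specialUnitaryGroup (Fin 2) ℂ)))
      (Uk : (k : ℕ) → GaugeField (F.P K) (k + 1) (Matrix.specialUnitaryGroup (Fin 2) ℂ) →
        GaugeField (F.P K) 0 (Matrix.specialUnitaryGroup (Fin 2) ℂ))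
      (UkH : (k : ℕ) → Hist (F.P K) k → GaugeField (F.P K) k (Matrix.specialUnitaryGroup (Fin 2) ℂ) →
        GaugeField (F.P K) 0 (Matrix.specialUnitaryGroup (Fin 2) ℂ))
      (hU0 : ∀ V : GaugeField (F.P K) 0 (Matrix.specialUnitaryGroup (Fin 2) ℂ), UkH 0 (Hist.triv (F.P K) 0) V = V)
      (hUs : ∀ (k : ℕ) (V : GaugeField (F.P K) (k + 1) (Matrix.specialUnitaryGroup (Fin 2) ℂ)),
        UkH (k + 1) (Hist.triv (F.P K) (k + 1)) V = Uk k V)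
      (𝔖 : ∀ k, StepSeries (T3Scales F γ hγ (hγ1.trans (sq_min_one_le _ 𝔠.gamma0_pos)) K)
        (Matrix.specialUnitaryGroup (Fin 2) ℂ) ↥(lieC (suGroupModel 2))
        (nblkOf (T3Scales F γ hγ (hγ1.trans (sq_min_one_le _ 𝔠.gamma0_pos)) K) 𝔠.lane.carrier k) k)
      (𝔄 : AlphaDataAC (suGroupModel 2) 𝔠
        (XT3 F γ hγ (hγ1.trans (sq_min_one_le _ 𝔠.gamma0_pos)) K reg Uk UkH hU0 hUs) 𝔖),
      RunAlphaV3ChiAC (suGroupModel 2) 𝔠 (XT3 F γ hγ (hγ1.trans (sq_min_one_le _ 𝔠.gamma0_pos)) K reg Uk UkH hU0 hUs) 𝔖 𝔄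
          (AlphaInputsT3AC.admWindowT3 F 𝔠 γ hγ hγ1 K) ∧
        MinimiserRowsT3 F 𝔠 γ hγ hγ1 a₀ a₁ K UkH ∧
          TerminalRowsT3 F 𝔠 γ hγ hγ1 K (XT3 F γ hγ (hγ1.trans (sq_min_one_le _ 𝔠.gamma0_pos)) K reg Uk UkH hU0 hUs) 𝔖 (𝔄.cP K)

/-- **`AlphaInputsT3ACv3RecChi L` — THE RECORD-PARAMETRIC χ-SOCKET** (the record named by the successor stub 2′χ `stub_laneRecordsV3chi`; `AlphaInputsT3ACv3Rec`'s text with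
`OfV3At ↦ OfV3ChiAt`): thresholds `b₁, p₁` such that for every profile `(b₀, p₀)` beyond them there is a primitive-constants record `𝔠` with EXACTLY that p-function and
[Balaban1985Variational] constants `a₀, a₁` such that the χ-package holds at those constants for EVERY three-torus family of block size `L`.  OPEN, never asserted.
[cite: Balaban1985UV3, (7) p.257 and Thm 2 p.272; Balaban1985Variational, Thm 1 (8) p.279] -/
def AlphaInputsT3ACv3RecChi (L : ℕ) : Prop :=
  ∃ (b₁ p₁ : ℝ), ∀ (b₀ p₀ : ℝ), b₁ ≤ b₀ → p₁ ≤ p₀ →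
    ∃ (𝔠 : AlphaConsts L (suGroupModel 2).N) (a₀ a₁ : ℝ), 𝔠.b₀ = b₀ ∧ 𝔠.p₀ = p₀ ∧ 0 < a₀ ∧ 0 < a₁ ∧ 𝔠.B₃ * a₁ ≤ a₀ ∧
      ∀ (F : T3Family) (hF : F.L = L), AlphaInputsT3AC.OfV3ChiAt F (hF ▸ 𝔠) a₀ a₁

/-! ## §2 The χ-package's data at `(γ, K)` and its projection to the core -/

section Pkg

variable (F : T3Family) (𝔠 : AlphaConsts F.L (suGroupModel 2).N) (γ : ℝ) (hγ : 0 < γ) (hγ1 : γ ≤ (min 𝔠.gamma0 1) ^ 2) (K : ℕ)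

/-- **THE χ-PACKAGE'S DATA AT `(γ, K)`**: `AlphaInputsT3AC.PkgAtV3`'s fields VERBATIM with `run : RunAlphaV3ChiAC …` — `OfV3ChiAt`'s ∃-clause as a record.
[cite: Balaban1985UV3, Thm 2 p.272; Balaban1985Variational, Thm 1 (8) p.279] -/
structure AlphaInputsT3AC.PkgAtV3Chi where
  /-- regular classes of [Balaban1985Variational] -/
  reg : ℕ → Set (GaugeField (F.P K) 0 (Matrix.specialUnitaryGroup (Fin 2) ℂ))
  /-- minimizers `U_k(V)` -/
  Uk : (k : ℕ) → GaugeField (F.P K) (k + 1) (Matrix.specialUnitaryGroup (Fin 2) ℂ) →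
    GaugeField (F.P K) 0 (Matrix.specialUnitaryGroup (Fin 2) ℂ)
  /-- composite minimizers `U_k(V, h)` of (42) -/
  UkH : (k : ℕ) → Hist (F.P K) k → GaugeField (F.P K) k (Matrix.specialUnitaryGroup (Fin 2) ℂ) →
    GaugeField (F.P K) 0 (Matrix.specialUnitaryGroup (Fin 2) ℂ)
  /-- `U_0(V, triv) = V` -/
  hU0 : ∀ V : GaugeField (F.P K) 0 (Matrix.specialUnitaryGroup (Fin 2) ℂ), UkH 0 (Hist.triv (F.P K) 0) V = V
  /-- `U_{k+1}(V, triv) = U_k(V)` -/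
  hUs : ∀ (k : ℕ) (V : GaugeField (F.P K) (k + 1) (Matrix.specialUnitaryGroup (Fin 2) ℂ)),
    UkH (k + 1) (Hist.triv (F.P K) (k + 1)) V = Uk k V
  /-- expansion data (chart values in `𝔰𝔲(2)ᶜ`) -/
  𝔖 : ∀ k, StepSeries (T3Scales F γ hγ (hγ1.trans (sq_min_one_le _ 𝔠.gamma0_pos)) K) (Matrix.specialUnitaryGroup (Fin 2) ℂ)
    ↥(lieC (suGroupModel 2)) (nblkOf (T3Scales F γ hγ (hγ1.trans (sq_min_one_le _ 𝔠.gamma0_pos)) K) 𝔠.lane.carrier k) k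
  /-- auxiliary (α) data -/
  𝔄 : AlphaDataAC (suGroupModel 2) 𝔠 (XT3 F γ hγ (hγ1.trans (sq_min_one_le _ 𝔠.gamma0_pos)) K reg Uk UkH hU0 hUs) 𝔖
  /-- the χ-record's (α) rows hold for these data at the (40) windows -/
  run : RunAlphaV3ChiAC (suGroupModel 2) 𝔠 (XT3 F γ hγ (hγ1.trans (sq_min_one_le _ 𝔠.gamma0_pos)) K reg Uk UkH hU0 hUs) 𝔖 𝔄
    (AlphaInputsT3AC.admWindowT3 F 𝔠 γ hγ hγ1 K)
  /-- the constant `a₀` of [Balaban1985Variational] Thm 1 -/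
  a₀ : ℝ
  /-- the constant `a₁` of [Balaban1985Variational] Thm 1 -/
  a₁ : ℝ
  /-- `0 < a₀`, `0 < a₁`, `B₃a₁ ≤ a₀` -/
  consts_ok : 0 < a₀ ∧ 0 < a₁ ∧ 𝔠.B₃ * a₁ ≤ a₀
  /-- the minimiser rows r1–r3 for `UkH` -/
  minRows : MinimiserRowsT3 F 𝔠 γ hγ hγ1 a₀ a₁ K UkH
  /-- the terminal data-regularity rows at `k = K` -/
  termRows : TerminalRowsT3 F 𝔠 γ hγ hγ1 K (XT3 F γ hγ (hγ1.trans (sq_min_one_le _ 𝔠.gamma0_pos)) K reg Uk UkH hU0 hUs) 𝔖 (𝔄.cP K)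

variable {F 𝔠 γ hγ hγ1 K} {a₀ a₁ : ℝ}

/-- **THE χ-PACKAGE PROJECTS TO THE CORE** (`run ↦ run.toCore`; every other field kept) — the (41)-side API is `PkgCoreV3`'s. [folklore] -/
def AlphaInputsT3AC.PkgAtV3Chi.toCore (p : AlphaInputsT3AC.PkgAtV3Chi F 𝔠 γ hγ hγ1 K) : AlphaInputsT3AC.PkgCoreV3 F 𝔠 γ hγ hγ1 K where
  reg := p.reg
  Uk := p.Uk
  UkH := p.UkH
  hU0 := p.hU0
  hUs := p.hUs
  𝔖 := p.𝔖
  𝔄 := p.𝔄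
  runCore := p.run.toCore
  a₀ := p.a₀
  a₁ := p.a₁
  consts_ok := p.consts_ok
  minRows := p.minRows
  termRows := p.termRows

/-- At given constants the χ-record exists with `a₀, a₁` EQUAL to the given ones. [cite: Balaban1985UV3, Thm 2 p.272] -/
theorem AlphaInputsT3AC.OfV3ChiAt.nonempty_pkgAtV3Chi (h : AlphaInputsT3AC.OfV3ChiAt F 𝔠 a₀ a₁) (hc : 0 < a₀ ∧ 0 < a₁ ∧ 𝔠.B₃ * a₁ ≤ a₀)
    (γ : ℝ) (hγ : 0 < γ) (hγ1 : γ ≤ (min 𝔠.gamma0 1) ^ 2) (K : ℕ) :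
    Nonempty {p : AlphaInputsT3AC.PkgAtV3Chi F 𝔠 γ hγ hγ1 K // p.a₀ = a₀ ∧ p.a₁ = a₁} := by
  obtain ⟨reg, Uk, UkH, hU0, hUs, 𝔖, 𝔄, hR, hM, hT⟩ := h γ hγ hγ1 K
  exact ⟨⟨⟨reg, Uk, UkH, hU0, hUs, 𝔖, 𝔄, hR, a₀, a₁, hc, hM, hT⟩, rfl, rfl⟩⟩

/-- **THE χ-RECORD AT GIVEN CONSTANTS, CHOSEN** — its `a₀`, `a₁` ARE the given ones. [cite: Balaban1985UV3, Thm 2 p.272] -/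
noncomputable def AlphaInputsT3AC.OfV3ChiAt.pkgAtV3Chi (h : AlphaInputsT3AC.OfV3ChiAt F 𝔠 a₀ a₁) (hc : 0 < a₀ ∧ 0 < a₁ ∧ 𝔠.B₃ * a₁ ≤ a₀)
    (γ : ℝ) (hγ : 0 < γ) (hγ1 : γ ≤ (min 𝔠.gamma0 1) ^ 2) (K : ℕ) :
    AlphaInputsT3AC.PkgAtV3Chi F 𝔠 γ hγ hγ1 K :=
  (Classical.choice (h.nonempty_pkgAtV3Chi hc γ hγ hγ1 K)).1

/-- The chosen record's `a₀` is the given `a₀`. [cite: Balaban1985Variational, Thm 1 (8) p.279] -/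
theorem AlphaInputsT3AC.OfV3ChiAt.pkgAtV3Chi_a₀ (h : AlphaInputsT3AC.OfV3ChiAt F 𝔠 a₀ a₁) (hc : 0 < a₀ ∧ 0 < a₁ ∧ 𝔠.B₃ * a₁ ≤ a₀)
    (γ : ℝ) (hγ : 0 < γ) (hγ1 : γ ≤ (min 𝔠.gamma0 1) ^ 2) (K : ℕ) :
    (h.pkgAtV3Chi hc γ hγ hγ1 K).a₀ = a₀ :=
  (Classical.choice (h.nonempty_pkgAtV3Chi hc γ hγ hγ1 K)).2.1

/-- The chosen record's `a₁` is the given `a₁`. [cite: Balaban1985Variational, Thm 1 (7)-(8) p.279] -/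
theorem AlphaInputsT3AC.OfV3ChiAt.pkgAtV3Chi_a₁ (h : AlphaInputsT3AC.OfV3ChiAt F 𝔠 a₀ a₁) (hc : 0 < a₀ ∧ 0 < a₁ ∧ 𝔠.B₃ * a₁ ≤ a₀)
    (γ : ℝ) (hγ : 0 < γ) (hγ1 : γ ≤ (min 𝔠.gamma0 1) ^ 2) (K : ℕ) :
    (h.pkgAtV3Chi hc γ hγ hγ1 K).a₁ = a₁ :=
  (Classical.choice (h.nonempty_pkgAtV3Chi hc γ hγ hγ1 K)).2.2

end Pkg

/-! ## §3 Print's (47) for the χ-package: a.e. on print's family and on the interior field window -/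

section Api

variable {F : T3Family} {𝔠 : AlphaConsts F.L (suGroupModel 2).N} {γ : ℝ} {hγ : 0 < γ} {hγ1 : γ ≤ (min 𝔠.gamma0 1) ^ 2} {K : ℕ}

/-- **THE INTERIOR FIELD WINDOW OF LEVEL `j`**: `|W(∂p) − 1| < θBal(K−j)/max(B₃,1)` at every plaquette — the (4)-window shrunk by [Balaban1985Variational]'s regularity constant, so that
the minimiser of every datum in it is `θBal(K−j)·η²`-regular (Thm 1 (8), the record's row r1) and the datum lies in print's validity family.  Consumers of a FIELD-window
lower bound (19936's denominator, E-INT's c-interior with `c ≤ 1/max(B₃,1)`) read (47) on this set. [cite: Balaban1985Variational, Thm 1 (8) p.279] -/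
def AlphaInputsT3AC.intWindowT3 (F : T3Family) (𝔠 : AlphaConsts F.L (suGroupModel 2).N) (γ : ℝ) (K j : ℕ) :
    Set (GaugeField (F.P K) j (Matrix.specialUnitaryGroup (Fin 2) ℂ)) :=
  {W | PlaqSmall (θBal F.L γ 𝔠.b₀ 𝔠.p₀ (K - j) / max 𝔠.B₃ 1) W}

/-- The interior window is measurable. [folklore] -/
theorem AlphaInputsT3AC.measurableSet_intWindowT3 (F : T3Family) (𝔠 : AlphaConsts F.L (suGroupModel 2).N) (γ : ℝ) (K j : ℕ) :
    MeasurableSet (AlphaInputsT3AC.intWindowT3 F 𝔠 γ K j) :=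
  T3UnitScaleTilt.measurableSet_plaqSmall _

namespace AlphaInputsT3AC.PkgAtV3Chi

variable (p : AlphaInputsT3AC.PkgAtV3Chi F 𝔠 γ hγ hγ1 K)

/-- The AC external inputs of the χ-package's data (= the core's). [cite: Balaban1985UV3, (2) p.256] -/
abbrev X : ExternalInputsAC (T3Scales F γ hγ (hγ1.trans (sq_min_one_le _ 𝔠.gamma0_pos)) K) (Matrix.specialUnitaryGroup (Fin 2) ℂ) := p.toCore.X

/-- The lane's AC tower of the χ-package's data (= the core's). [cite: Balaban1985UV3, (38)–(43) p.266] -/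
abbrev T : B10.TowerRun := p.toCore.T

/-- The tower's start constant `E` (= the core's). [cite: Balaban1985UV3, (62) p.271] -/
abbrev E : ℝ := p.toCore.E

/-- **PRINT'S (47) FOR THE χ-PACKAGE'S TOWER ON PRINT'S VALIDITY FAMILY, `dV`-a.e., every `j ≤ K`** (`AlphaV3AC.ineq47On_ae_of_alphaV3Chi` on the window `T3Scales_window`, terminal
data rows from `termRows`): `𝟙[loPrintAC j](V)·exp(−mainT_j(triv,V) + Pint_j(triv,V) − E_j − Rm_j) ≤ ρ_j(V)` a.e. [cite: Balaban1985UV3, (47) p.267 + Thm 2 p.272] -/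
theorem ineq47Print_ae (j : ℕ) (hj : j ≤ K) :
    ∀ᵐ V ∂fieldMeasure (F.P K) j (Matrix.specialUnitaryGroup (Fin 2) ℂ),
      (PinnedStep.loPrintAC 𝔠.lane p.X j).indicator (fun _ => (1 : ℝ)) V *
          Real.exp (-(p.T.mainT j (Hist.triv (F.P K) j) V) + p.T.Pint j (Hist.triv (F.P K) j) V - p.T.Ecst j - p.T.Rm j) ≤ p.T.ρ j V :=
  ineq47On_ae_of_alphaV3Chi (T3Scales_window F 𝔠 γ hγ hγ1 K) p.run (p.termRows.1 _) (p.termRows.2.1 _) (p.termRows.2.2 _) j hj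

/-- Auxiliary form of the bridge at the levels `K − n`, `n < K` (at least one averaging step): the interior window lies in print's family — row r1 at the FREE radius
`θBal(n)/max(B₃,1)` puts the trivial-history minimiser in `𝔘(B₃·θBal(n)/max(B₃,1)) ⊆ 𝔘(θBal(n))`. [cite: Balaban1985Variational, Thm 1 (8) p.279] -/
theorem intWindowT3_subset_loPrintAC_aux (ha₁ : ∀ i, θBal F.L γ 𝔠.b₀ 𝔠.p₀ i ≤ p.a₁) (n : ℕ) (hnK : n < K) :
    AlphaInputsT3AC.intWindowT3 F 𝔠 γ K (K - n) ⊆ PinnedStep.loPrintAC 𝔠.lane p.X (K - n) := by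
  have hB1 : 1 ≤ max 𝔠.B₃ 1 := le_max_right _ _
  have hB0 : 0 < max 𝔠.B₃ 1 := lt_of_lt_of_le one_pos hB1
  have hBle : 𝔠.B₃ ≤ max 𝔠.B₃ 1 := le_max_left _ _
  have hnn : K - (K - n) = n := Nat.sub_sub_self hnK.le
  have hθ : 0 < θBal F.L γ 𝔠.b₀ 𝔠.p₀ n := by
    have := p.toCore.θBal_pos (K - n) (Nat.sub_le _ _); rwa [hnn] at this
  have heps : eps1Of (T3Scales F γ hγ (hγ1.trans (sq_min_one_le _ 𝔠.gamma0_pos)) K) 𝔠.lane.carrier (K - n) = θBal F.L γ 𝔠.b₀ 𝔠.p₀ n := by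
    have := p.toCore.eps1_eq (K - n) (Nat.sub_le _ _); rwa [hnn] at this
  -- the letters of row r1 at the free radius `ε₁ := θ/max(B₃,1)`, `ε₀ := B₃ε₁`
  set ε₁ : ℝ := θBal F.L γ 𝔠.b₀ 𝔠.p₀ n / max 𝔠.B₃ 1 with hε₁
  have hε₁0 : 0 < ε₁ := div_pos hθ hB0
  have hε₁θ : ε₁ ≤ θBal F.L γ 𝔠.b₀ 𝔠.p₀ n := div_le_self hθ.le hB1
  have hε₁a : ε₁ ≤ p.a₁ := hε₁θ.trans (ha₁ n)
  have hB3ε₁ : 𝔠.B₃ * ε₁ ≤ θBal F.L γ 𝔠.b₀ 𝔠.p₀ n := by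
    rw [hε₁]
    calc 𝔠.B₃ * (θBal F.L γ 𝔠.b₀ 𝔠.p₀ n / max 𝔠.B₃ 1) ≤ max 𝔠.B₃ 1 * (θBal F.L γ 𝔠.b₀ 𝔠.p₀ n / max 𝔠.B₃ 1) :=
          mul_le_mul_of_nonneg_right hBle (div_nonneg hθ.le hB0.le)
      _ = θBal F.L γ 𝔠.b₀ 𝔠.p₀ n := mul_div_cancel₀ _ hB0.ne'
  have hhi : 𝔠.B₃ * ε₁ ≤ p.a₀ := by
    have h1 : 𝔠.B₃ * ε₁ ≤ 𝔠.B₃ * p.a₁ := mul_le_mul_of_nonneg_left hε₁a 𝔠.B₃_pos.le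
    exact h1.trans p.consts_ok.2.2
  refine PinnedStep.plaqSmall_subset_loPrintAC 𝔠.lane p.X (K - n) (δ := θBal F.L γ 𝔠.b₀ 𝔠.p₀ (K - (K - n)) / max 𝔠.B₃ 1) ?_ ?_
  · rw [hnn, heps]; exact hε₁θ
  · intro V hV
    rw [hnn] at hV
    rw [heps, ← p.X.UkH_triv (K - n) V]
    -- shift the datum to height `n`, level `0`, apply row r1, shift back
    let hsh := F.sitesPerDir_eq (m := F.m) (K := K) (j := K - n) (m' := F.m) (K' := n) (j' := 0) (by omega)
    have hV₀ : PlaqSmall ε₁ (fieldShift hsh.symm V) := (T3CruxEstimates.plaqSmall_fieldShift F hsh.symm ε₁ V).mpr hV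
    have hr1 := (p.minRows.1 n hnK ε₁ (𝔠.B₃ * ε₁) hε₁0 hε₁a le_rfl hhi (fieldShift hsh.symm V) hV₀).1
    rw [T3LevelShift.fieldShift_symm_fieldShift] at hr1
    have hreg : PlaqSmall (regThreshold F n K (𝔠.B₃ * ε₁)) (p.UkH (K - n) (Hist.triv (F.P K) (K - n)) V) :=
      ((T3PrintedRegularMinimiser.mem_regFibrePr_iff F).mp hr1).2.1
    intro q
    have hq := hreg q
    refine hq.trans_le ?_
    show 𝔠.B₃ * ε₁ * ((F.L : ℝ)⁻¹) ^ (2 * (K - n)) ≤ θBal F.L γ 𝔠.b₀ 𝔠.p₀ n * ((F.L : ℝ)⁻¹) ^ (2 * (K - n))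
    exact mul_le_mul_of_nonneg_right hB3ε₁ (pow_nonneg (inv_nonneg.mpr (Nat.cast_nonneg _)) _)

/-- **THE INTERIOR WINDOW LIES IN PRINT'S VALIDITY FAMILY, every level `j ≤ K`** (`j = 0`: `U_0 = id`; `j ≥ 1`: row r1), under the [Balaban1985Variational] data-smallness threshold
`θBal ≤ a₁` (γ small; the consumer's `exists_gamma_thresholds`). [cite: Balaban1985Variational, Thm 1 (8) p.279] -/
theorem intWindowT3_subset_loPrintAC (ha₁ : ∀ i, θBal F.L γ 𝔠.b₀ 𝔠.p₀ i ≤ p.a₁) (j : ℕ) (hj : j ≤ K) :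
    AlphaInputsT3AC.intWindowT3 F 𝔠 γ K j ⊆ PinnedStep.loPrintAC 𝔠.lane p.X j := by
  rcases Nat.eq_zero_or_pos j with rfl | hj1
  · have hB1 : 1 ≤ max 𝔠.B₃ 1 := le_max_right _ _
    have hθ : 0 < θBal F.L γ 𝔠.b₀ 𝔠.p₀ (K - 0) := p.toCore.θBal_pos 0 (Nat.zero_le _)
    have heps : eps1Of (T3Scales F γ hγ (hγ1.trans (sq_min_one_le _ 𝔠.gamma0_pos)) K) 𝔠.lane.carrier 0 = θBal F.L γ 𝔠.b₀ 𝔠.p₀ (K - 0) :=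
      p.toCore.eps1_eq 0 (Nat.zero_le _)
    refine PinnedStep.plaqSmall_subset_loPrintAC 𝔠.lane p.X 0 (δ := θBal F.L γ 𝔠.b₀ 𝔠.p₀ (K - 0) / max 𝔠.B₃ 1) ?_ ?_
    · rw [heps]; exact div_le_self hθ.le hB1
    · intro V hV q
      simp only [mul_zero, pow_zero, mul_one]
      rw [heps]
      exact (hV q).trans_le (div_le_self hθ.le hB1)
  · have h := p.intWindowT3_subset_loPrintAC_aux ha₁ (K - j) (by omega)
    rwa [Nat.sub_sub_self hj] at h

/-- **PRINT'S (47) ON THE INTERIOR FIELD WINDOW, `dV`-a.e., every `j ≤ K`**: `𝟙[intWindowT3 j](V)·exp(−mainT_j(triv,V) + Pint_j(triv,V) − E_j − Rm_j) ≤ ρ_j(V)` a.e. — the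
(5)-shape lower bound [Balaban1985UV3] p.256 with the FIELD window shrunk to where [Balaban1985Variational] Thm 1 (8) puts the minimiser inside print's χ of (47).
[cite: Balaban1985UV3, (5) p.256 + (47) p.267; Balaban1985Variational, Thm 1 (8) p.279] -/
theorem ineq47Int_ae (ha₁ : ∀ i, θBal F.L γ 𝔠.b₀ 𝔠.p₀ i ≤ p.a₁) (j : ℕ) (hj : j ≤ K) :
    ∀ᵐ V ∂fieldMeasure (F.P K) j (Matrix.specialUnitaryGroup (Fin 2) ℂ),
      (AlphaInputsT3AC.intWindowT3 F 𝔠 γ K j).indicator (fun _ => (1 : ℝ)) V *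
          Real.exp (-(p.T.mainT j (Hist.triv (F.P K) j) V) + p.T.Pint j (Hist.triv (F.P K) j) V - p.T.Ecst j - p.T.Rm j) ≤ p.T.ρ j V :=
  ineq47On_ae_mono (𝔊 := suGroupModel 2) (𝔖 := p.𝔖) (lo' := AlphaInputsT3AC.intWindowT3 F 𝔠 γ K) j (p.intWindowT3_subset_loPrintAC ha₁ j hj) (p.ineq47Print_ae j hj)

/-- **(47)′ FOR THE ROUTE'S DENSITY WITH THE INTERIOR INDICATOR, `dV`-a.e., CONSTANTS PULLED OUT**: for `j ≤ K`, almost every `W`,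
`exp(−(E_j − E) − Rm_j)·𝟙[intWindowT3 j](W)·exp(−mainT_j(triv,W) + Pint_j(triv,W)) ≤ resDensity F γ K univ j W` — `AlphaInputsT3AC.PkgAtV3.le_resDensity_ae`'s text with the
tower's (4)-window `T.χ_j` replaced by the interior indicator (`ineq47Int_ae` and `resDensity = e^{E}ρ_j` a.e.). [cite: Balaban1985UV3, (47) p.267 + Thm 2 p.272] -/
theorem le_resDensity_int_ae (ha₁ : ∀ i, θBal F.L γ 𝔠.b₀ 𝔠.p₀ i ≤ p.a₁) (j : ℕ) (hj : j ≤ K) :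
    ∀ᵐ W ∂fieldMeasure (F.P K) j (Matrix.specialUnitaryGroup (Fin 2) ℂ),
      Real.exp (-(p.T.Ecst j - p.E) - p.T.Rm j) *
          ((AlphaInputsT3AC.intWindowT3 F 𝔠 γ K j).indicator (fun _ => (1 : ℝ)) W *
            Real.exp (-(p.T.mainT j (p.T.triv j) W) + p.T.Pint j (p.T.triv j) W)) ≤
        resDensity F γ K Set.univ j W := by
  filter_upwards [p.ineq47Int_ae ha₁ j hj, p.toCore.resDensity_ae_eq j (by omega)] with W hb hW
  rw [hW]
  have hsplit : (AlphaInputsT3AC.intWindowT3 F 𝔠 γ K j).indicator (fun _ => (1 : ℝ)) W *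
        Real.exp (-(p.T.mainT j (p.T.triv j) W) + p.T.Pint j (p.T.triv j) W - p.T.Ecst j - p.T.Rm j) =
      Real.exp (-(p.T.Ecst j) - p.T.Rm j) *
        ((AlphaInputsT3AC.intWindowT3 F 𝔠 γ K j).indicator (fun _ => (1 : ℝ)) W *
          Real.exp (-(p.T.mainT j (p.T.triv j) W) + p.T.Pint j (p.T.triv j) W)) := by
    rw [mul_left_comm, ← Real.exp_add]; congr 2; ring
  have hb' := hb
  change (AlphaInputsT3AC.intWindowT3 F 𝔠 γ K j).indicator (fun _ => (1 : ℝ)) W *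
      Real.exp (-(p.T.mainT j (p.T.triv j) W) + p.T.Pint j (p.T.triv j) W - p.T.Ecst j - p.T.Rm j) ≤ p.T.ρ j W at hb'
  rw [hsplit] at hb'
  have hE : Real.exp (-(p.T.Ecst j - p.E) - p.T.Rm j) = Real.exp p.E * Real.exp (-(p.T.Ecst j) - p.T.Rm j) := by
    rw [← Real.exp_add]; congr 1; ring
  rw [hE, mul_assoc]
  exact mul_le_mul_of_nonneg_left hb' (Real.exp_nonneg _)

end AlphaInputsT3AC.PkgAtV3Chi

end Api

end Summit.QuantumFields.YangMills.Theorems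

end
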